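import Literature.Geometry.Riemannian.HeatKernelDuality
import Literature.Geometry.Riemannian.TimeDerivativeContinuity
import Mathlib.MeasureTheory.Integral.IntervalIntegral.FundThmCalculus
import HarnessLib

/-!
# Pairing a conjugate heat solution with a space-time test function along a Ricci flow
# (Bamler 2020a, §2.3)

R. Bamler, *Entropy and heat kernel bounds on a Ricci flow background*, arXiv:2008.07093 (2020a),
§2.3: along a (super) Ricci flow the conjugate heat operator is `□* = −∂ₜ − Δ + R`, and the heat
kernel `K(x,t;·,·)` solves `□* K(x,t;·,·) = 0` in the backward variables. The very weak form of
"`v` solves `□* v = 0` on `M × [s, t]`" is the identity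

  `d/dr ∫_M ζ(r) v(r) dV_{h(r)} = ∫_M (∂ᵣζ − Δ_{h(r)} ζ(r)) v(r) dV_{h(r)}`

for EVERY smooth space-time test function `ζ` (the scalar-curvature terms of `∂ᵣv = −Δv + Rv`
and of `∂ᵣ dV = −R dV` cancel, and `∫ ζ Δv dV = ∫ (Δζ) v dV` by Green's identity; Topping 2006,
(6.3.2), `d/dt ∫ w dV = −∫ □*w dV`, applied to `w = ζ v`). This file PROVES it for a smooth family
`h` of Riemannian metrics on a closed manifold `M` (modelled on `ℝᵐ`) which is a Ricci flow on
`[s, t]`, `s < t`, and a smooth conjugate heat solution `v` (`IsConjugateHeatSolutionOn`,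
`ToppingEntropyIntegrand.lean`):

* `IsRicciFlow.hasDerivWithinAt_integral_mul_conjugateHeat` — the derivative (within `[s, t]`,
  one-sided at the end points) of `r ↦ ∫ ζ(r) v(r) dV_{h(r)}` is `∫ (∂ᵣζ − Δζ) v dV_{h(r)}`;
* `IsRicciFlow.continuousOn_integral_testDeriv_mul_conjugateHeat` — that derivative is continuous
  on `[s, t]` (it is again the integral of a smooth space-time function against `dV_{h(r)}`);
* `IsRicciFlow.integral_mul_sub_integral_mul_eq_intervalIntegral` — the **integrated form**
  `∫ ζ(t)v(t) dV_{h(t)} − ∫ ζ(s)v(s) dV_{h(s)} = ∫ₛᵗ ∫ (∂ᵣζ − Δζ) v dV_{h(r)} dr`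
  (fundamental theorem of calculus).

The special case of a heat solution `ζ` (right-hand side `0`) is the duality
`IsRicciFlow.integral_mul_eq_of_heat_conjugateHeat` of `HeatKernelDuality.lean`, whose computation is
repeated here keeping the term `(∂ᵣζ − Δζ) v`. Everything is proved; no definitions, no named
facts.

## References

* R. H. Bamler, *Entropy and heat kernel bounds on a Ricci flow background*, arXiv:2008.07093
  (2020), §2.3 (conjugate heat operator, `□* K(x,t;·,·) = 0`, duality). [Bamler2020Entropy]
* P. Topping, *Lectures on the Ricci flow*, LMS Lecture Note Series 325, CUP 2006, §6.3,
  Rem. 6.3.2, (6.3.2) (p. 57). [Topping2006]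
-/

noncomputable section

open Bundle Set Function Filter Manifold MeasureTheory Measure TopologicalSpace
open scoped Manifold ContDiff Topology ENNReal NNReal

namespace Literature.Geometry.Riemannian

open Lorentzian Lorentzian.PseudoRiemannianMetric

section TestPairing

variable {m : ℕ} {H : Type*} [TopologicalSpace H]
  {I : ModelWithCorners ℝ (EuclideanSpace ℝ (Fin m)) H} [I.Boundaryless]
  {M : Type*} [TopologicalSpace M] [ChartedSpace H M] [IsManifold I ∞ M]
  [T2Space M] [CompactSpace M] [SecondCountableTopology M] [MeasurableSpace M] [BorelSpace M]
  {h : ℝ → PseudoRiemannianMetric I ∞ (EuclideanSpace ℝ (Fin m)) (TangentSpace I : M → Type _)}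
  {cov : ℝ → CovariantDerivative I (EuclideanSpace ℝ (Fin m)) (TangentSpace I : M → Type _)}

omit [SecondCountableTopology M] in
/-- **Pairing a conjugate heat solution with a test function** (Bamler 2020a, §2.3, the very weak
form of `□* v = 0`; Topping 2006, (6.3.2) `d/dt ∫ w dV = −∫ □*w dV` applied to `w = ζ v`): for a
Ricci flow of Riemannian metrics `(h, cov)` on `[s, t]`, `s < t`, on a closed manifold modelled on
`ℝᵐ`, a smooth space-time function `ζ` on `M × [s, t]` and a smooth conjugate heat solution `v`
(`∂ᵣv = −Δv + Rv`, `IsConjugateHeatSolutionOn`) on `M × [s, t]`, at every `r ∈ [s, t]`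

  `d/dr ∫ ζ(r) v(r) dV_{h(r)} = ∫ (∂ᵣζ(r) − Δ_{h(r)} ζ(r)) v(r) dV_{h(r)}`

(derivative within `[s, t]`; `d/dr ∫ ζv dV = ∫ (∂ᵣ(ζv) − R ζv) dV = ∫ (∂ᵣζ v − ζ Δv) dV` and
`∫ ζ Δv dV = ∫ (Δζ) v dV` by Green's identity). [cite: Bamler2020Entropy, §2.3] -/
theorem IsRicciFlow.hasDerivWithinAt_integral_mul_conjugateHeat {s t : ℝ}
    (hflow : IsRicciFlow h cov (Icc s t)) (hst : s < t) (hR : ∀ r ∈ Icc s t, (h r).IsRiemannian)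
    {ζ v : ℝ → M → ℝ}
    (hζ : ContMDiffOn (I.prod 𝓘(ℝ, ℝ)) 𝓘(ℝ, ℝ) ∞ (fun p : M × ℝ ↦ ζ p.2 p.1) (univ ×ˢ Icc s t))
    (hv : IsConjugateHeatSolutionOn h cov (Icc s t) v) {r : ℝ} (hr : r ∈ Icc s t) :
    HasDerivWithinAt (fun r' ↦ ∫ x, ζ r' x * v r' x ∂(h r').riemVolume)
      (∫ x, (derivWithin (fun r' ↦ ζ r' x) (Icc s t) r - (h r).laplaceBeltrami (ζ r) x) * v r x
        ∂(h r).riemVolume) (Icc s t) r := by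
  have h1le : (1 : ℕ∞ω) ≤ (∞ : ℕ∞ω) := WithTop.coe_le_coe.mpr le_top
  have h2le : (2 : ℕ∞ω) ≤ (∞ : ℕ∞ω) := WithTop.coe_le_coe.mpr le_top
  have hS : Convex ℝ (Icc s t) := convex_Icc s t
  have hU : UniqueDiffOn ℝ (Icc s t) := uniqueDiffOn_Icc hst
  -- the product is smooth on `M × [s, t]`
  have hζv : ContMDiffOn (I.prod 𝓘(ℝ, ℝ)) 𝓘(ℝ, ℝ) ∞ (fun p : M × ℝ ↦ ζ p.2 p.1 * v p.2 p.1)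
      (univ ×ˢ Icc s t) := hζ.mul hv.1
  -- its time derivative at `r`
  have hderiv : ∀ x, derivWithin (fun r' ↦ ζ r' x * v r' x) (Icc s t) r =
      derivWithin (fun r' ↦ ζ r' x) (Icc s t) r * v r x +
        ζ r x * (-(h r).laplaceBeltrami (v r) x + (h r).scalarCurvatureWith (cov r) x * v r x) := by
    intro x
    have hdζ := hasDerivWithinAt_time_of_contMDiffOn (by simp) hζ x hr
    have hdv : HasDerivWithinAt (fun r' ↦ v r' x)
        (-(h r).laplaceBeltrami (v r) x + (h r).scalarCurvatureWith (cov r) x * v r x)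
        (Icc s t) r := by
      have h0 := hasDerivWithinAt_time_of_contMDiffOn (by simp) hv.1 x hr
      rwa [hv.2 r hr x] at h0
    exact (hdζ.mul hdv).derivWithin (hU r hr)
  -- `d/dr ∫ ζ v dV = ∫ (∂ᵣ(ζv) − R ζ v) dV`
  have hder := hflow.hasDerivWithinAt_integral_of_contMDiffOn hS hR
    (v := fun r x ↦ ζ r x * v r x) hζv hr
  refine hder.congr_deriv ?_
  -- continuity of the slices at time `r`
  have hζr : ContMDiff I 𝓘(ℝ, ℝ) ∞ (ζ r) := contMDiff_slice_of_contMDiffOn hζ hr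
  have hvr : ContMDiff I 𝓘(ℝ, ℝ) ∞ (v r) := contMDiff_slice_of_contMDiffOn hv.1 hr
  have hLζ : Continuous fun x ↦ (h r).laplaceBeltrami (ζ r) x :=
    (contMDiff_slice_of_contMDiffOn (u := fun r' x ↦ (h r').laplaceBeltrami (ζ r') x)
      (hflow.smooth.contMDiffOn_laplaceBeltrami hU hζ) hr).continuous
  have hLv : Continuous fun x ↦ (h r).laplaceBeltrami (v r) x :=
    (contMDiff_slice_of_contMDiffOn (u := fun r' x ↦ (h r').laplaceBeltrami (v r') x)
      (hflow.smooth.contMDiffOn_laplaceBeltrami hU hv.1) hr).continuous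
  have hdζc : Continuous fun x ↦ derivWithin (fun r' ↦ ζ r' x) (Icc s t) r :=
    (contMDiff_slice_of_contMDiffOn
      (u := fun r' x ↦ derivWithin (fun r'' ↦ ζ r'' x) (Icc s t) r')
      (contMDiffOn_derivWithin_time_of_uniqueDiffOn hU hζ) hr).continuous
  have e1 : (fun x ↦ derivWithin (fun r' ↦ ζ r' x * v r' x) (Icc s t) r -
      (h r).scalarCurvatureWith (cov r) x * (ζ r x * v r x)) =
      fun x ↦ (derivWithin (fun r' ↦ ζ r' x) (Icc s t) r - (h r).laplaceBeltrami (ζ r) x) *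
        v r x +
        (v r x * (h r).laplaceBeltrami (ζ r) x - ζ r x * (h r).laplaceBeltrami (v r) x) := by
    funext x
    rw [hderiv x]
    ring
  have hA : Integrable (fun x ↦ (derivWithin (fun r' ↦ ζ r' x) (Icc s t) r -
      (h r).laplaceBeltrami (ζ r) x) * v r x) (h r).riemVolume :=
    (h r).integrable_of_continuous ((hdζc.sub hLζ).mul hvr.continuous)
  have hB₁ : Integrable (fun x ↦ v r x * (h r).laplaceBeltrami (ζ r) x) (h r).riemVolume :=
    (h r).integrable_of_continuous (hvr.continuous.mul hLζ)
  have hB₂ : Integrable (fun x ↦ ζ r x * (h r).laplaceBeltrami (v r) x) (h r).riemVolume :=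
    (h r).integrable_of_continuous (hζr.continuous.mul hLv)
  have hB : Integrable (fun x ↦ v r x * (h r).laplaceBeltrami (ζ r) x -
      ζ r x * (h r).laplaceBeltrami (v r) x) (h r).riemVolume := hB₁.sub hB₂
  rw [e1, integral_add hA hB, integral_sub hB₁ hB₂,
    integral_mul_laplaceBeltrami_eq_neg_integral_innerDual (hR r hr) (hvr.of_le h1le)
      (hζr.of_le h2le),
    integral_mul_laplaceBeltrami_eq_neg_integral_innerDual (hR r hr) (hζr.of_le h1le)
      (hvr.of_le h2le)]
  simp only [PseudoRiemannianMetric.innerDual_comm, sub_self, add_zero]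

omit [SecondCountableTopology M] in
/-- **Continuity of `r ↦ ∫ (∂ᵣζ − Δ_{h(r)}ζ) v dV_{h(r)}` on `[s, t]`**, in the setting of
`IsRicciFlow.hasDerivWithinAt_integral_mul_conjugateHeat`: the integrand
`(∂ᵣζ − Δ_{h(r)}ζ(r)) v(r)` is again smooth on `M × [s, t]` (time derivatives and Laplacians of
smooth space-time functions are smooth, `contMDiffOn_derivWithin_time_of_uniqueDiffOn`,
`IsContMDiffFamilyOn.contMDiffOn_laplaceBeltrami`), so its integral against `dV_{h(r)}` is even
differentiable within `[s, t]` (`IsRicciFlow.hasDerivWithinAt_integral_of_contMDiffOn`).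
[cite: Bamler2020Entropy, §2.3] -/
theorem IsRicciFlow.continuousOn_integral_testDeriv_mul_conjugateHeat {s t : ℝ}
    (hflow : IsRicciFlow h cov (Icc s t)) (hst : s < t) (hR : ∀ r ∈ Icc s t, (h r).IsRiemannian)
    {ζ v : ℝ → M → ℝ}
    (hζ : ContMDiffOn (I.prod 𝓘(ℝ, ℝ)) 𝓘(ℝ, ℝ) ∞ (fun p : M × ℝ ↦ ζ p.2 p.1) (univ ×ˢ Icc s t))
    (hv : IsConjugateHeatSolutionOn h cov (Icc s t) v) :
    ContinuousOn (fun r ↦ ∫ x, (derivWithin (fun r' ↦ ζ r' x) (Icc s t) r -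
      (h r).laplaceBeltrami (ζ r) x) * v r x ∂(h r).riemVolume) (Icc s t) := by
  have hS : Convex ℝ (Icc s t) := convex_Icc s t
  have hU : UniqueDiffOn ℝ (Icc s t) := uniqueDiffOn_Icc hst
  -- the integrand is smooth on `M × [s, t]`
  have hF : ContMDiffOn (I.prod 𝓘(ℝ, ℝ)) 𝓘(ℝ, ℝ) ∞
      (fun p : M × ℝ ↦ (derivWithin (fun r' ↦ ζ r' p.1) (Icc s t) p.2 -
        (h p.2).laplaceBeltrami (ζ p.2) p.1) * v p.2 p.1) (univ ×ˢ Icc s t) :=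
    ((contMDiffOn_derivWithin_time_of_uniqueDiffOn hU hζ).sub
      (hflow.smooth.contMDiffOn_laplaceBeltrami hU hζ)).mul hv.1
  intro r hr
  exact (hflow.hasDerivWithinAt_integral_of_contMDiffOn hS hR
    (v := fun r x ↦ (derivWithin (fun r' ↦ ζ r' x) (Icc s t) r -
      (h r).laplaceBeltrami (ζ r) x) * v r x) hF hr).continuousWithinAt

omit [SecondCountableTopology M] in
/-- **Pairing a conjugate heat solution with a test function, integrated form** (Bamler 2020a,
§2.3, the very weak form of `□* v = 0` on `M × [s, t]`): for a Ricci flow of Riemannian metrics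
`(h, cov)` on `[s, t]`, `s < t`, on a closed manifold modelled on `ℝᵐ`, a smooth space-time
function `ζ` on `M × [s, t]` and a smooth conjugate heat solution `v` on `M × [s, t]`,

  `∫ ζ(t) v(t) dV_{h(t)} − ∫ ζ(s) v(s) dV_{h(s)} = ∫ₛᵗ ∫ (∂ᵣζ(r) − Δ_{h(r)}ζ(r)) v(r) dV_{h(r)} dr`

(the fundamental theorem of calculus for `r ↦ ∫ ζ(r)v(r) dV_{h(r)}`, whose derivative
`IsRicciFlow.hasDerivWithinAt_integral_mul_conjugateHeat` is continuous on `[s, t]`,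
`IsRicciFlow.continuousOn_integral_testDeriv_mul_conjugateHeat`). [cite: Bamler2020Entropy, §2.3] -/
theorem IsRicciFlow.integral_mul_sub_integral_mul_eq_intervalIntegral {s t : ℝ}
    (hflow : IsRicciFlow h cov (Icc s t)) (hst : s < t) (hR : ∀ r ∈ Icc s t, (h r).IsRiemannian)
    {ζ v : ℝ → M → ℝ}
    (hζ : ContMDiffOn (I.prod 𝓘(ℝ, ℝ)) 𝓘(ℝ, ℝ) ∞ (fun p : M × ℝ ↦ ζ p.2 p.1) (univ ×ˢ Icc s t))
    (hv : IsConjugateHeatSolutionOn h cov (Icc s t) v) :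
    ∫ x, ζ t x * v t x ∂(h t).riemVolume - ∫ x, ζ s x * v s x ∂(h s).riemVolume =
      ∫ r in s..t, ∫ x, (derivWithin (fun r' ↦ ζ r' x) (Icc s t) r -
        (h r).laplaceBeltrami (ζ r) x) * v r x ∂(h r).riemVolume := by
  have hcont : ContinuousOn (fun r' ↦ ∫ x, ζ r' x * v r' x ∂(h r').riemVolume) (Icc s t) :=
    fun r hr ↦ (hflow.hasDerivWithinAt_integral_mul_conjugateHeat hst hR hζ hv hr).continuousWithinAt
  have hderiv : ∀ r ∈ Ioo s t, HasDerivAt (fun r' ↦ ∫ x, ζ r' x * v r' x ∂(h r').riemVolume)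
      (∫ x, (derivWithin (fun r' ↦ ζ r' x) (Icc s t) r - (h r).laplaceBeltrami (ζ r) x) * v r x
        ∂(h r).riemVolume) r := fun r hr ↦
    (hflow.hasDerivWithinAt_integral_mul_conjugateHeat hst hR hζ hv
      (Ioo_subset_Icc_self hr)).hasDerivAt (Icc_mem_nhds hr.1 hr.2)
  have hint : IntervalIntegrable (fun r ↦ ∫ x, (derivWithin (fun r' ↦ ζ r' x) (Icc s t) r -
      (h r).laplaceBeltrami (ζ r) x) * v r x ∂(h r).riemVolume) volume s t :=
    (hflow.continuousOn_integral_testDeriv_mul_conjugateHeat hst hR hζ hv).intervalIntegrable_of_Icc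
      hst.le
  exact (intervalIntegral.integral_eq_sub_of_hasDerivAt_of_le hst.le hcont hderiv hint).symm

end TestPairing

end Literature.Geometry.Riemannian
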